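import Summits.NavierStokesRegularity.NavierStokesRegularity.Theorems.EfficiencyFloorRigidExitReferenceShadowingScale
import Summits.NavierStokesRegularity.NavierStokesRegularity.Theorems.EfficiencyFloorRigidExitReferenceShadowingRobustness
import Literature.Analysis.FluidPDE.PressurePoisson
import Literature.Analysis.FluidPDE.BKMClassGradientContinuity
import Literature.Analysis.FluidPDE.SerrinEnstrophyGronwall
import HarnessLib

/-!
# Route `EfficiencyFloor`, support `RigidExit` (stmt-NavierStokesRegularity-25513) on the `ProductionEfficiencyDecay` ladder
# (stmt-NavierStokesRegularity-22866): THE `δ → 0⁺` GLUE — the `H¹` defect between a slab solution and the reference flow at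
# time `δ` tends to the vorticity distance of the data

Helper file (`--supports stmt-NavierStokesRegularity-22866`; line `efficiency_floor`). The windowed shadowing estimate
(`ReferenceShadowing.shadow_window`, p840284) bounds `∫|∇(u−v)(τ)|²_F` by the defect `D ≥ ∫|∇(u−v)(δ)|²_F` at a positive time
`δ`, with a `δ`-free constant. This file supplies the limit `δ → 0⁺` of the defect (census item 2 of hand g24, "δ → 0⁺ glue"):

* `lintegral_iteratedFDeriv_sub_lt_top` — Sobolev finiteness of a difference of two smooth Sobolev-finite fields;
* `defect_eventually_lt` — for the reference flow `(v,q)` through an admissible `m` (Leray package) and ANY classical solution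
  `(u,p)` on a slab `[0,τ₂]` in the `L²`-Sobolev class: if `∫‖curl(u 0 − m)‖² < D'` then `∫|∇(u−v)(δ)|²_F < D'` for all small
  `δ > 0` (div–curl identity for the divergence-free difference, the `L²` triangle inequality for vorticities
  (`sqrt_enstrophy_sub_le`), `∫‖curl(v δ − m)‖² → 0` (`ReferenceFlow.tendsto_enstrophy_sub_nhdsGT`, p839781) and
  `∫|∇(u δ − u 0)|²_F → 0` (continuity of the gradient enstrophy of the jointly smooth field `t ↦ u t − u 0` in the BKM class,
  `IsSmoothSpaceTimeOn.enstrophy_balance`)).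

HONEST FRAMING: bookkeeping between two given smooth solutions; (R-shadow), `RigidExit`, `NearMaximiserBoundedAmplification`,
`LerayFloorGap`, `ProductionEfficiencyDecay` (stmt-22866) and Navier–Stokes regularity stay OPEN; no summit statement is proved.
[folklore]
-/

-- the problem directory repeats the summit name (`NavierStokesRegularity/NavierStokesRegularity`)
set_option linter.dupNamespace false

noncomputable section

open Set Filter MeasureTheory Topology Function InnerProductSpace
open scoped InnerProductSpace RealInnerProductSpace ENNReal NNReal ContDiff
open Literature.Analysis.FluidPDE

namespace Summit.NavierStokesRegularity.NavierStokesRegularity.Theorems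

namespace RigidExit

namespace ReferenceShadowing

section Limit

variable {ν T : ℝ} {m : EuclideanSpace ℝ (Fin 3) → EuclideanSpace ℝ (Fin 3)}
  {v : ℝ → EuclideanSpace ℝ (Fin 3) → EuclideanSpace ℝ (Fin 3)} {q : ℝ → EuclideanSpace ℝ (Fin 3) → ℝ}

/-- Sobolev finiteness of a difference: `∫⁻‖Dⁿ(a − b)‖ₑ² < ∞` for smooth `a, b` with `∫⁻‖Dⁿa‖ₑ², ∫⁻‖Dⁿb‖ₑ² < ∞`. [folklore] -/
theorem lintegral_iteratedFDeriv_sub_lt_top {a b : EuclideanSpace ℝ (Fin 3) → EuclideanSpace ℝ (Fin 3)}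
    (ha : ContDiff ℝ (⊤ : ℕ∞) a) (hb : ContDiff ℝ (⊤ : ℕ∞) b) (n : ℕ)
    (hA : ∫⁻ x, ‖iteratedFDeriv ℝ n a x‖ₑ ^ 2 < ⊤) (hB : ∫⁻ x, ‖iteratedFDeriv ℝ n b x‖ₑ ^ 2 < ⊤) :
    ∫⁻ x, ‖iteratedFDeriv ℝ n (a - b) x‖ₑ ^ 2 < ⊤ := by
  have hsub : ∀ x, iteratedFDeriv ℝ n (a - b) x = iteratedFDeriv ℝ n a x - iteratedFDeriv ℝ n b x := fun x =>
    iteratedFDeriv_sub_apply (ha.of_le (by exact_mod_cast le_top)).contDiffAt (hb.of_le (by exact_mod_cast le_top)).contDiffAt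
  have hm : AEStronglyMeasurable (fun x => iteratedFDeriv ℝ n a x) volume :=
    (ha.continuous_iteratedFDeriv (by exact_mod_cast le_top)).aestronglyMeasurable
  calc ∫⁻ x, ‖iteratedFDeriv ℝ n (a - b) x‖ₑ ^ 2 = ∫⁻ x, ‖iteratedFDeriv ℝ n a x - iteratedFDeriv ℝ n b x‖ₑ ^ 2 :=
        lintegral_congr fun x => by rw [hsub]
    _ ≤ 2 * (∫⁻ x, ‖iteratedFDeriv ℝ n a x‖ₑ ^ 2) + 2 * ∫⁻ x, ‖iteratedFDeriv ℝ n b x‖ₑ ^ 2 := lintegral_enorm_sq_sub_le hm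
    _ < ⊤ := ENNReal.add_lt_top.2 ⟨ENNReal.mul_lt_top (by simp) hA, ENNReal.mul_lt_top (by simp) hB⟩

/-- **The `δ → 0⁺` glue.** Let `(v,q)` be the reference flow through an admissible `m` (Leray package on `[0,T]`) and `(u,p)` a
classical forcing-free solution on `[0,τ₂] × ℝ³`, `τ₂ > 0`, with all Sobolev norms of `u` and `∂ₜu` bounded. If
`∫‖curl(u 0 − m)‖² < D'` then `∫|∇(u−v)(δ)|²_F < D'` for all sufficiently small `δ > 0`. [folklore] -/
theorem defect_eventually_lt (hT : 0 < T) (hLH : IsLerayHopfOn T ν 0 m v) (hv0 : v 0 = m)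
    (hH1 : IsH1RegularOn (Icc 0 T) v) (hcl : IsClassicalNSSolutionOn (Ioc 0 T) ν 0 v q)
    (hB : ∀ δ : ℝ, 0 < δ → δ ≤ T → HasBoundedSobolevNormsOn (Icc δ T) v)
    (hm : ContDiff ℝ (⊤ : ℕ∞) m ∧ VectorCalculus.IsDivFree m ∧ (∫⁻ x, ‖iteratedFDeriv ℝ 0 m x‖ₑ ^ 2 < ⊤) ∧
      (∫⁻ x, ‖iteratedFDeriv ℝ 1 m x‖ₑ ^ 2 < ⊤) ∧ (∫⁻ x, ‖iteratedFDeriv ℝ 2 m x‖ₑ ^ 2 < ⊤))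
    {u : ℝ → EuclideanSpace ℝ (Fin 3) → EuclideanSpace ℝ (Fin 3)} {p : ℝ → EuclideanSpace ℝ (Fin 3) → ℝ} {τ₂ : ℝ}
    (hτ₂ : 0 < τ₂) (hu : IsClassicalNSSolutionOn (Icc 0 τ₂) ν 0 u p) (hU : HasBoundedSobolevNormsOn (Icc 0 τ₂) u)
    (hUt : HasBoundedSobolevNormsOn (Icc 0 τ₂) (timeDerivWithin (Icc 0 τ₂) u)) {D' : ℝ}
    (hD' : (∫ x, ‖curl (u 0 - m) x‖ ^ 2) < D') :
    ∀ᶠ δ in 𝓝[>] 0, (∫ x, frobeniusNormSq (fderiv ℝ ((u - v) δ) x)) < D' := by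
  obtain ⟨hmsm, hmdiv, hm0, hm1, hm2⟩ := hm
  -- Sobolev finiteness along `u` on `[0, τ₂]` and along `v` at positive times
  have hufin : ∀ t ∈ Icc 0 τ₂, ∀ n : ℕ, ∫⁻ x, ‖iteratedFDeriv ℝ n (u t) x‖ₑ ^ 2 < ⊤ := fun t ht n => by
    obtain ⟨C, hC⟩ := hU n
    exact (hC t ht).trans_lt ENNReal.coe_lt_top
  have hvfin : ∀ t ∈ Ioc 0 T, ∀ n : ℕ, ∫⁻ x, ‖iteratedFDeriv ℝ n (v t) x‖ₑ ^ 2 < ⊤ := fun t ht n => by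
    obtain ⟨C, hC⟩ := hB t ht.1 ht.2 n
    exact (hC t ⟨le_rfl, ht.2⟩).trans_lt ENNReal.coe_lt_top
  have husm : ∀ t ∈ Icc 0 τ₂, ContDiff ℝ (⊤ : ℕ∞) (u t) := fun t ht => hu.contDiff_velocity ht
  have hvsm : ∀ t ∈ Ioc 0 T, ContDiff ℝ (⊤ : ℕ∞) (v t) := fun t ht => hcl.contDiff_velocity ht
  have h0τ : (0 : ℝ) ∈ Icc 0 τ₂ := ⟨le_rfl, hτ₂.le⟩
  -- (1) `∫‖curl(v δ − m)‖² → 0`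
  have hZv : Tendsto (fun t => ∫ x, ‖curl (v t - m) x‖ ^ 2) (𝓝[>] 0) (𝓝 0) :=
    ReferenceFlow.tendsto_enstrophy_sub_nhdsGT hT hLH hv0 hH1 hcl hB ⟨hmsm, hmdiv, hm0, hm1, hm2⟩
  -- (2) `∫|∇(u δ − u 0)|²_F → 0`: continuity of the gradient enstrophy of `t ↦ u t − u 0`
  set w : ℝ → EuclideanSpace ℝ (Fin 3) → EuclideanSpace ℝ (Fin 3) := fun t => u t - u 0 with hwdef
  have hwsm : IsSmoothSpaceTimeOn (Icc 0 τ₂) w := by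
    have hc : IsSmoothSpaceTimeOn (Icc 0 τ₂) (fun _ : ℝ => u 0) := by
      have h : ContDiff ℝ ∞ (fun z : ℝ × EuclideanSpace ℝ (Fin 3) => u 0 z.2) := (husm 0 h0τ).comp contDiff_snd
      exact h.contDiffOn
    exact hu.smooth_velocity.sub hc
  have hw1 : ∃ C : ℝ≥0, ∀ t ∈ Icc 0 τ₂, ∫⁻ x, ‖iteratedFDeriv ℝ 1 (w t) x‖ₑ ^ 2 ≤ C := by
    have hconst : ∀ n : ℕ, ∃ C : ℝ≥0, ∀ t ∈ Icc 0 τ₂, ∫⁻ x, ‖iteratedFDeriv ℝ n ((fun _ : ℝ => u 0) t) x‖ₑ ^ 2 ≤ C :=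
      fun n => ⟨(∫⁻ x, ‖iteratedFDeriv ℝ n (u 0) x‖ₑ ^ 2).toNNReal, fun t _ => by
        rw [ENNReal.coe_toNNReal (hufin 0 h0τ n).ne]⟩
    exact sobolev_sub husm (fun t _ => husm 0 h0τ) hU hconst 1
  have hwt1 : ∃ C : ℝ≥0, ∀ t ∈ Icc 0 τ₂, ∫⁻ x, ‖iteratedFDeriv ℝ 1 (timeDerivWithin (Icc 0 τ₂) w t) x‖ₑ ^ 2 ≤ C := by
    obtain ⟨C, hC⟩ := hUt 1
    refine ⟨C, fun t ht => ?_⟩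
    have heq : timeDerivWithin (Icc 0 τ₂) w t = timeDerivWithin (Icc 0 τ₂) u t := by
      funext x
      simp only [timeDerivWithin_apply, hwdef, Pi.sub_apply]
      exact derivWithin_sub_const _
    rw [heq]
    exact hC t ht
  obtain ⟨C₁, hC₁⟩ := hw1
  obtain ⟨C₂, hC₂⟩ := hwt1
  obtain ⟨-, hGc, -⟩ := hwsm.enstrophy_balance hτ₂ hC₁ hC₂
  have hG0 : (∫ x, frobeniusNormSq (fderiv ℝ (w 0) x)) = 0 := by
    have : w 0 = fun _ => 0 := by funext x; simp [hwdef]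
    rw [this]
    simp [frobeniusNormSq_zero]
  have hGu : Tendsto (fun t => ∫ x, frobeniusNormSq (fderiv ℝ (w t) x)) (𝓝[>] 0) (𝓝 0) := by
    have h1 : Tendsto (fun t => ∫ x, frobeniusNormSq (fderiv ℝ (w t) x)) (𝓝[Icc 0 τ₂] 0) (𝓝 0) := by
      have h := (hGc 0 h0τ).tendsto
      rw [hG0] at h
      exact h
    refine h1.mono_left (nhdsWithin_le_of_mem ?_)
    exact mem_of_superset (Ioo_mem_nhdsGT hτ₂) Ioo_subset_Icc_self
  -- `∫‖curl(u δ − u 0)‖² = ∫|∇(u δ − u 0)|²_F` on `[0, τ₂]` (div–curl)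
  have hZu_eq : ∀ t ∈ Icc 0 τ₂, (∫ x, ‖curl (u t - u 0) x‖ ^ 2) = ∫ x, frobeniusNormSq (fderiv ℝ (w t) x) := by
    intro t ht
    have hsm : ContDiff ℝ (⊤ : ℕ∞) (u t - u 0) := (husm t ht).sub (husm 0 h0τ)
    have hdiv : VectorCalculus.IsDivFree (u t - u 0) := fun x => by
      rw [show (u t - u 0) = fun y => u t y - u 0 y from rfl,
        divergence_sub_apply ((husm t ht).differentiable (by norm_cast) x)
          ((husm 0 h0τ).differentiable (by norm_cast) x), hu.divFree t ht x, hu.divFree 0 h0τ x, sub_zero]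
    have hf : ∀ n : ℕ, ∫⁻ x, ‖iteratedFDeriv ℝ n (u t - u 0) x‖ₑ ^ 2 < ⊤ := fun n =>
      lintegral_iteratedFDeriv_sub_lt_top (husm t ht) (husm 0 h0τ) n (hufin t ht n) (hufin 0 h0τ n)
    have h0' : ∫⁻ x, ‖(u t - u 0) x‖ₑ ^ 2 < ⊤ := by
      refine lt_of_le_of_lt (le_of_eq (lintegral_congr fun x => ?_)) (hf 0)
      rw [← ofReal_norm, ← ofReal_norm, norm_iteratedFDeriv_zero]
    exact (integral_frobeniusNormSq_fderiv_eq_integral_norm_curl_sq (hsm.of_le (by norm_cast)) hdiv h0' (hf 1) (hf 2)).symm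
  have hZu : Tendsto (fun t => ∫ x, ‖curl (u t - u 0) x‖ ^ 2) (𝓝[>] 0) (𝓝 0) := by
    refine hGu.congr' ?_
    filter_upwards [mem_of_superset (Ioo_mem_nhdsGT hτ₂) Ioo_subset_Icc_self] with t ht
    exact (hZu_eq t ht).symm
  -- (3) the bound `√X(δ) ≤ √Z(u0 − m) + √Z(u δ − u 0) + √Z(v δ − m)` for small `δ > 0`, and `X = Z` of the difference
  have hτT : 0 < min τ₂ T := lt_min hτ₂ hT
  have hbound : ∀ᶠ δ in 𝓝[>] 0, (∫ x, frobeniusNormSq (fderiv ℝ ((u - v) δ) x)) ≤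
      (Real.sqrt (∫ x, ‖curl (u 0 - m) x‖ ^ 2) + Real.sqrt (∫ x, ‖curl (u δ - u 0) x‖ ^ 2) +
        Real.sqrt (∫ x, ‖curl (v δ - m) x‖ ^ 2)) ^ 2 := by
    filter_upwards [Ioo_mem_nhdsGT hτT] with δ hδ
    have hδu : δ ∈ Icc 0 τ₂ := ⟨hδ.1.le, (hδ.2.trans_le (min_le_left _ _)).le⟩
    have hδv : δ ∈ Ioc 0 T := ⟨hδ.1, (hδ.2.trans_le (min_le_right _ _)).le⟩
    -- the players
    have su : ContDiff ℝ (⊤ : ℕ∞) (u δ) := husm δ hδu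
    have sv : ContDiff ℝ (⊤ : ℕ∞) (v δ) := hvsm δ hδv
    have s0 : ContDiff ℝ (⊤ : ℕ∞) (u 0) := husm 0 h0τ
    have sF : ContDiff ℝ (⊤ : ℕ∞) (u δ - v δ) := su.sub sv
    have sP : ContDiff ℝ (⊤ : ℕ∞) (u δ - m) := su.sub hmsm
    have sQ : ContDiff ℝ (⊤ : ℕ∞) (u 0 - m) := s0.sub hmsm
    have f_uv : ∀ n : ℕ, ∫⁻ x, ‖iteratedFDeriv ℝ n (u δ - v δ) x‖ₑ ^ 2 < ⊤ := fun n =>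
      lintegral_iteratedFDeriv_sub_lt_top su sv n (hufin δ hδu n) (hvfin δ hδv n)
    have fP1 : ∫⁻ x, ‖iteratedFDeriv ℝ 1 (u δ - m) x‖ₑ ^ 2 < ⊤ :=
      lintegral_iteratedFDeriv_sub_lt_top su hmsm 1 (hufin δ hδu 1) hm1
    have fQ1 : ∫⁻ x, ‖iteratedFDeriv ℝ 1 (u 0 - m) x‖ₑ ^ 2 < ⊤ :=
      lintegral_iteratedFDeriv_sub_lt_top s0 hmsm 1 (hufin 0 h0τ 1) hm1
    -- `X(δ) = Z(u δ − v δ)` (div–curl)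
    have hdivF : VectorCalculus.IsDivFree (u δ - v δ) := fun x => by
      rw [show (u δ - v δ) = fun y => u δ y - v δ y from rfl,
        divergence_sub_apply (su.differentiable (by norm_cast) x) (sv.differentiable (by norm_cast) x),
        hu.divFree δ hδu x, hcl.divFree δ hδv x, sub_zero]
    have h0F : ∫⁻ x, ‖(u δ - v δ) x‖ₑ ^ 2 < ⊤ := by
      refine lt_of_le_of_lt (le_of_eq (lintegral_congr fun x => ?_)) (f_uv 0)
      rw [← ofReal_norm, ← ofReal_norm, norm_iteratedFDeriv_zero]
    have hXZ : (∫ x, frobeniusNormSq (fderiv ℝ ((u - v) δ) x)) = ∫ x, ‖curl (u δ - v δ) x‖ ^ 2 := by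
      rw [show (u - v) δ = u δ - v δ from rfl]
      exact integral_frobeniusNormSq_fderiv_eq_integral_norm_curl_sq (sF.of_le (by norm_cast)) hdivF h0F (f_uv 1) (f_uv 2)
    -- two triangle inequalities
    have e1 : (u δ - m) - (u δ - v δ) = v δ - m := by funext x; simp only [Pi.sub_apply]; abel
    have e2 : (u δ - m) - (u 0 - m) = u δ - u 0 := by funext x; simp only [Pi.sub_apply]; abel
    have t1 := sqrt_enstrophy_sub_le sP fP1 sF (f_uv 1)
    rw [e1] at t1
    have t2 := sqrt_enstrophy_sub_le sP fP1 sQ fQ1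
    rw [e2] at t2
    have i1 := (abs_sub_le_iff.1 t1).2
    have i2 := (abs_sub_le_iff.1 t2).1
    have hS : Real.sqrt (∫ x, ‖curl (u δ - v δ) x‖ ^ 2) ≤
        Real.sqrt (∫ x, ‖curl (u 0 - m) x‖ ^ 2) + Real.sqrt (∫ x, ‖curl (u δ - u 0) x‖ ^ 2) +
          Real.sqrt (∫ x, ‖curl (v δ - m) x‖ ^ 2) := by linarith
    have hZF : 0 ≤ ∫ x, ‖curl (u δ - v δ) x‖ ^ 2 := integral_nonneg fun x => by positivity
    rw [hXZ, ← Real.sq_sqrt hZF]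
    exact pow_le_pow_left₀ (Real.sqrt_nonneg _) hS 2
  -- (4) the right-hand side tends to `Z(u 0 − m) < D'`
  have hZQ : 0 ≤ ∫ x, ‖curl (u 0 - m) x‖ ^ 2 := integral_nonneg fun x => by positivity
  have hlim : Tendsto (fun δ => (Real.sqrt (∫ x, ‖curl (u 0 - m) x‖ ^ 2) + Real.sqrt (∫ x, ‖curl (u δ - u 0) x‖ ^ 2) +
        Real.sqrt (∫ x, ‖curl (v δ - m) x‖ ^ 2)) ^ 2) (𝓝[>] 0)
      (𝓝 ((Real.sqrt (∫ x, ‖curl (u 0 - m) x‖ ^ 2) + Real.sqrt 0 + Real.sqrt 0) ^ 2)) :=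
    ((tendsto_const_nhds.add hZu.sqrt).add hZv.sqrt).pow 2
  have hval : (Real.sqrt (∫ x, ‖curl (u 0 - m) x‖ ^ 2) + Real.sqrt 0 + Real.sqrt 0) ^ 2 < D' := by
    rw [Real.sqrt_zero, add_zero, add_zero, Real.sq_sqrt hZQ]
    exact hD'
  filter_upwards [hbound, hlim.eventually (gt_mem_nhds hval)] with δ h1 h2
  exact h1.trans_lt h2

end Limit

end ReferenceShadowing

end RigidExit

end Summit.NavierStokesRegularity.NavierStokesRegularity.Theorems

end
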